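import Summits.Schanuel.Schanuel.Theorems.RootDecomp1HCurveHullMerge

/-!
# RootDecomp1H ∩ RootDecomp1J — CONVERGENCE THEOREM, part 3: 𝓚 ≤ 𝒯̂, «THE TOWER HULL IS THE CURVE HULL», interchangeability

`exp_mem_towerHullSet`, `mem_towerHullSet_of_exp_mem`, `baker_mem_towerHullSet`, `curve_mem_towerHullSet` ⟹ `curveHull_le_towerHull`;
`structural_iff_schanuelOn_curveHull : (ProductSchanuel ∧ RelTowerSchanuel) ↔ SchanuelOn 𝓚` (route 1H's structural side ⟺ Schanuel on 1J's
curve hull); `towerHull_eq_curveHull`; `inTowerHull_iff_mem_curveHull`; `bridgeTransverse_iff_bridgeOffCurve` (1H's declared residual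
`BridgeTransverse` stmt-Schanuel-30564 IS the effective gap principle at first failures with a coordinate OFF 𝓚 — the complement on which 1J's
residual K₂ = G₂ ∧ K₃ lives: ONE residual domain); `schanuel_of_structural_of_curveClosedFields` / `schanuel_of_structural_of_pairSplit` :
1H.ProductSchanuel → 1H.RelTowerSchanuel → 1J.SchanuelOverCurveClosedFields (resp. G₂, K₃) → Schanuel (through the landed
`RootDecomp1DFlagSplit.schanuelOn_of_relOn` and `RootDecomp1JPairSplit`).  Port of lens-5 `prover/RootDecomp1HCurveHull.port.lean` §§4–5
(critic: FOREST RULING R1, ACCEPTED 08:21:52Z); 0 sorry.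
-/

set_option linter.dupNamespace false

noncomputable section

namespace Summit.Schanuel.Schanuel.Theorems.RootDecomp1HCurveHull

open Complex Set
open Summit.Schanuel.Schanuel.Theses.RootDecomp1H (ProductSchanuel RelTowerSchanuel BridgeTransverse)
open Summit.Schanuel.Schanuel.Theses.RootDecomp1J (SchanuelOverCurveClosedFields PairBlocksOverCurveClosedFields
  SchanuelOverPairClosedFields SchanuelOverCurveClosedFieldsGlue)
open Summit.Schanuel.Schanuel.Theorems.RootDecomp1HTowerCells (trdeg_adjoin_adjoin_eq adjoin_le_of_mem_span_int
  trdeg_le_of_mem_span_int exists_scaled_family linearIndependent_scaled trdeg_le_of_depthOne trdeg_adjoin_union_le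
  trdeg_adjoin_range_le)
open Summit.Schanuel.Schanuel.Theorems.RootDecomp1HProductCells (eRk_le_of_span_eq le_trdeg_of_natCast_le_eRk)
open Summit.Schanuel.Schanuel.Theorems.RootDecomp1HHull (prefix_subset prefix_trdeg_le_of_eq hull_of_product_of_relTower)
open Summit.Schanuel.Schanuel.Theorems.RootDecomp1DFlagSplit (schanuelOn_of_relOn)
open Summit.Schanuel.Schanuel.Theorems.RootDecomp1JPairSplit (schanuelOverCurveClosedFieldsGlue_holds)
open Literature.NumberTheory.Transcendental (OneMotiveToric.trdeg_mono trdeg_adjoin_le_of_le exists_nsmul_mem_span_int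
  mem_adjoin_of_mem_span_int)

/-! ## 4. `𝒯̂` contains `𝓛⋆` and is closed under 1J's exp / log / curve steps; hence `𝓚 ≤ 𝒯̂` -/

/-- The tower hull is closed under `exp` (extend the tower by the exponential: depth ≤ 1 over the tower field). -/
theorem exp_mem_towerHullSet {x : ℂ} (hx : x ∈ towerHullSet) : cexp x ∈ towerHullSet := by
  obtain ⟨N, b, hb, hbtow, hxb⟩ := hx
  obtain ⟨M, hM, hMx⟩ := exists_nsmul_mem_span_int b hxb
  let bt : Fin N → ℂ := fun i => (M : ℚ)⁻¹ • b i
  have hq : ∀ i : Fin N, (fun _ : Fin N => (M : ℚ)⁻¹) i ≠ 0 := fun _ => inv_ne_zero (Nat.cast_ne_zero.2 hM)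
  have hbt : LinearIndependent ℚ bt := linearIndependent_smul hb (fun _ => (M : ℚ)⁻¹) hq
  have hbttow : TowerTuple bt := towerTuple_smul hbtow (fun _ => (M : ℚ)⁻¹) hq
  have hxZ : x ∈ Submodule.span ℤ (range bt) := mem_span_int_smul_inv b hM hMx
  have hex : cexp x ∈ IntermediateField.adjoin ℚ (range bt ∪ range (cexp ∘ bt)) := (mem_adjoin_of_mem_span_int bt hxZ).2
  have hg : Algebra.trdeg ℚ ↥(IntermediateField.adjoin ℚ ((range bt ∪ range (cexp ∘ bt)) ∪ ({cexp x, cexp (cexp x)} : Set ℂ)))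
      ≤ ((N + 1 : ℕ) : Cardinal) := by
    rw [Nat.cast_succ]
    exact (trdeg_adjoin_pair_le_of_mem hex).trans (add_le_add (trdeg_le_of_towerTuple hbttow) le_rfl)
  obtain ⟨L, c, hc, hctow, -, hmem⟩ := exists_tower_extension hbt hbttow hg
  exact ⟨L, c, hc, hctow, hmem⟩

/-- The tower hull is closed under logarithms. -/
theorem mem_towerHullSet_of_exp_mem {y : ℂ} (hy : cexp y ∈ towerHullSet) : y ∈ towerHullSet := by
  obtain ⟨N, b, hb, hbtow, hyb⟩ := hy
  obtain ⟨M, hM, hMy⟩ := exists_nsmul_mem_span_int b hyb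
  let bt : Fin N → ℂ := fun i => (M : ℚ)⁻¹ • b i
  have hq : ∀ i : Fin N, (fun _ : Fin N => (M : ℚ)⁻¹) i ≠ 0 := fun _ => inv_ne_zero (Nat.cast_ne_zero.2 hM)
  have hbt : LinearIndependent ℚ bt := linearIndependent_smul hb (fun _ => (M : ℚ)⁻¹) hq
  have hbttow : TowerTuple bt := towerTuple_smul hbtow (fun _ => (M : ℚ)⁻¹) hq
  have hyZ : cexp y ∈ Submodule.span ℤ (range bt) := mem_span_int_smul_inv b hM hMy
  have hex : cexp y ∈ IntermediateField.adjoin ℚ (range bt ∪ range (cexp ∘ bt)) := (mem_adjoin_of_mem_span_int bt hyZ).1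
  have hg : Algebra.trdeg ℚ ↥(IntermediateField.adjoin ℚ ((range bt ∪ range (cexp ∘ bt)) ∪ ({y, cexp y} : Set ℂ)))
      ≤ ((N + 1 : ℕ) : Cardinal) := by
    rw [Nat.cast_succ]
    exact (trdeg_adjoin_pair_le_of_exp_mem hex).trans (add_le_add (trdeg_le_of_towerTuple hbttow) le_rfl)
  obtain ⟨L, c, hc, hctow, -, hmem⟩ := exists_tower_extension hbt hbttow hg
  exact ⟨L, c, hc, hctow, hmem⟩

/-- Baker periods `β·l` lie in the tower hull. -/
theorem baker_mem_towerHullSet {β l : ℂ} (hβ : IsAlgebraic ℚ β) (hl : IsAlgebraic ℚ (cexp l)) : β * l ∈ towerHullSet := by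
  obtain ⟨N, b, hb, hbtow, hlb⟩ := mem_towerHullSet_of_depthOne (depthOne_of_isAlgebraic_exp hl)
  have hlF : l ∈ IntermediateField.adjoin ℚ (range b ∪ range (cexp ∘ b)) := mem_adjoin_of_mem_span b hlb
  have hg : Algebra.trdeg ℚ ↥(IntermediateField.adjoin ℚ ((range b ∪ range (cexp ∘ b)) ∪ ({β * l, cexp (β * l)} : Set ℂ)))
      ≤ ((N + 1 : ℕ) : Cardinal) := by
    rw [Nat.cast_succ]
    exact (trdeg_adjoin_pair_le_of_baker hβ hlF).trans (add_le_add (trdeg_le_of_towerTuple hbtow) le_rfl)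
  obtain ⟨L, c, hc, hctow, -, hmem⟩ := exists_tower_extension hb hbtow hg
  exact ⟨L, c, hc, hctow, hmem⟩

/-- CURVE-CLOSURE of `𝒯̂` (under `TowerSchanuel`). -/
theorem curve_mem_towerHullSet (hTS : TowerSchanuel) (Y : Finset ℂ) (hY : (↑Y : Set ℂ) ⊆ towerHullSet) {g : ℂ}
    (hcond : CurveCond Y g) : g ∈ towerHullSet := by
  obtain ⟨N, b, hb, hbtow, hYb⟩ := exists_tower_of_finset hTS Y hY
  obtain ⟨M, hM, hMY⟩ := exists_common_scaling b Y fun y hy => hYb (Finset.mem_coe.mpr hy)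
  let bt : Fin N → ℂ := fun i => (M : ℚ)⁻¹ • b i
  have hq : ∀ i : Fin N, (fun _ : Fin N => (M : ℚ)⁻¹) i ≠ 0 := fun _ => inv_ne_zero (Nat.cast_ne_zero.2 hM)
  have hbt : LinearIndependent ℚ bt := linearIndependent_smul hb (fun _ => (M : ℚ)⁻¹) hq
  have hbttow : TowerTuple bt := towerTuple_smul hbtow (fun _ => (M : ℚ)⁻¹) hq
  have hYZ : ∀ y ∈ Y, y ∈ Submodule.span ℤ (range bt) := fun y hy => mem_span_int_smul_inv b hM (hMY y hy)
  set St : Set ℂ := range bt ∪ range (cexp ∘ bt) with hSt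
  set Lt : IntermediateField ℚ ℂ := IntermediateField.adjoin ℚ St with hLt
  set FY : IntermediateField ℚ ℂ := IntermediateField.adjoin ℚ ((↑Y : Set ℂ) ∪ Complex.exp '' ↑Y) with hFY
  set T : Set ℂ := ({g, cexp g} : Set ℂ) with hT
  have hFYLt : FY ≤ Lt := by
    rw [IntermediateField.adjoin_le_iff]
    rintro a (ha | ⟨y, hy, rfl⟩)
    · exact (mem_adjoin_of_mem_span_int bt (hYZ a (Finset.mem_coe.mp ha))).1
    · exact (mem_adjoin_of_mem_span_int bt (hYZ y (Finset.mem_coe.mp hy))).2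
  have hrel : Algebra.trdeg Lt (IntermediateField.adjoin Lt T) ≤ 1 := (trdeg_adjoin_le_of_le hFYLt T).trans hcond
  have htower : Algebra.trdeg ℚ Lt + Algebra.trdeg Lt (IntermediateField.adjoin Lt T) =
      Algebra.trdeg ℚ ↥(IntermediateField.adjoin ℚ (St ∪ T)) := trdeg_adjoin_adjoin_eq (K := ℚ) St T
  have hg : Algebra.trdeg ℚ ↥(IntermediateField.adjoin ℚ (St ∪ T)) ≤ ((N + 1 : ℕ) : Cardinal) := by
    rw [← htower, Nat.cast_succ]
    exact add_le_add (trdeg_le_of_towerTuple hbttow) hrel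
  obtain ⟨L, c, hc, hctow, -, hmem⟩ := exists_tower_extension hbt hbttow hg
  exact ⟨L, c, hc, hctow, hmem⟩

/-- `𝓛⋆ ≤ 𝒯̂`: the Baker-star span lies in the tower hull. -/
theorem bakerStarSpan_le_towerHull (hTS : TowerSchanuel) : bakerStarSpan ≤ towerHull hTS := by
  refine Submodule.span_le.2 ?_
  rintro z (hz | ⟨β, l, hβ, hl, rfl⟩)
  · exact mem_towerHullSet_of_depthOne (depthOne_of_isAlgebraic hz)
  · exact baker_mem_towerHullSet hβ hl

/-- The tower hull is closed under 1J's exp/log step. -/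
theorem elStep_le_towerHull (hTS : TowerSchanuel) {E : Submodule ℚ ℂ} (hE : E ≤ towerHull hTS) :
    elStep E ≤ towerHull hTS := by
  have h₁ : E ⊔ Submodule.span ℚ (Complex.exp '' ↑E) ≤ towerHull hTS := by
    refine sup_le hE (Submodule.span_le.2 ?_)
    rintro _ ⟨x, hx, rfl⟩
    exact exp_mem_towerHullSet (hE hx)
  refine sup_le h₁ (Submodule.span_le.2 ?_)
  intro y hy
  exact mem_towerHullSet_of_exp_mem (h₁ hy)

/-- The tower hull is closed under 1J's curve step. -/
theorem curveStep_le_towerHull (hTS : TowerSchanuel) {E : Submodule ℚ ℂ} (hE : E ≤ towerHull hTS) :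
    curveStep E ≤ towerHull hTS := by
  refine sup_le hE (Submodule.span_le.2 ?_)
  rintro g ⟨Y, hYE, hcond⟩
  exact curve_mem_towerHullSet hTS Y (fun y hy => hE (hYE hy)) hcond

/-- The tower hull is curve-closed. -/
theorem isCurveClosed_towerHull (hTS : TowerSchanuel) : IsCurveClosed (towerHull hTS) :=
  curveStep_le_towerHull hTS le_rfl

/-- A step-closed subspace containing `X` contains every iterate of the step applied to `X`. -/
theorem iterate_le_of_step {f : Submodule ℚ ℂ → Submodule ℚ ℂ} {K X : Submodule ℚ ℂ}
    (hf : ∀ E, E ≤ K → f E ≤ K) (hX : X ≤ K) : ∀ n : ℕ, f^[n] X ≤ K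
  | 0 => hX
  | n + 1 => by
    rw [Function.iterate_succ_apply']
    exact hf _ (iterate_le_of_step hf hX n)

/-- `𝓜 ≤ 𝒯̂`: the exp-log hull lies in the tower hull. -/
theorem expLogHull_le_towerHull (hTS : TowerSchanuel) : expLogHull ≤ towerHull hTS :=
  iSup_le fun n => iterate_le_of_step (fun _ hE => elStep_le_towerHull hTS hE) (bakerStarSpan_le_towerHull hTS) (n + 1)

/-- **`𝓚 ≤ 𝒯̂`**. -/
theorem curveHull_le_towerHull (hTS : TowerSchanuel) : curveHull ≤ towerHull hTS :=
  iSup_le fun n => iterate_le_of_step (fun _ hE => curveStep_le_towerHull hTS hE) (expLogHull_le_towerHull hTS) (n + 1)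

/-! ## 5. The equivalence, the identification of the hulls, the residual domain, interchangeability -/

/-- **(→) `TowerSchanuel → SchanuelOn 𝓚`**: a `ℚ`-free tuple of `𝓚 ⊆ 𝒯̂` lies in the span of ONE free tower (merge), where
the landed hull theorem applies. -/
theorem schanuelOn_curveHull_of_towerSchanuel (hTS : TowerSchanuel) : SchanuelOn curveHull := by
  intro n x hxK hx
  obtain ⟨N, b, hb, hbtow, hmem⟩ :=
    exists_tower_of_mem_towerHullSet hTS (y := x) fun i => curveHull_le_towerHull hTS (hxK i)
  exact hull_of_product_of_relTower (productSchanuel_of_towerSchanuel hTS) (relTowerSchanuel_of_towerSchanuel hTS)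
    N b hb hbtow n x hx hmem

/-- **THE EQUIVALENCE**: `TowerSchanuel ↔ SchanuelOn 𝓚`. -/
theorem towerSchanuel_iff_schanuelOn_curveHull : TowerSchanuel ↔ SchanuelOn curveHull :=
  ⟨schanuelOn_curveHull_of_towerSchanuel, towerSchanuel_of_schanuelOn curveHull isCurveClosed_curveHull⟩

/-- **… OVER THE ROUTE CONSTANTS**: 1H's structural side `ProductSchanuel ∧ RelTowerSchanuel` ⟺ Schanuel on 1J's curve hull `𝓚`. -/
theorem structural_iff_schanuelOn_curveHull : (ProductSchanuel ∧ RelTowerSchanuel) ↔ SchanuelOn curveHull :=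
  towerSchanuel_iff_structural.symm.trans towerSchanuel_iff_schanuelOn_curveHull

/-- Route 1H's structural side gives Schanuel on the curve hull. -/
theorem schanuelOn_curveHull_of_structural (hPS : ProductSchanuel) (hRT : RelTowerSchanuel) : SchanuelOn curveHull :=
  structural_iff_schanuelOn_curveHull.1 ⟨hPS, hRT⟩

/-- Schanuel on the curve hull gives route 1H's structural side. -/
theorem structural_of_schanuelOn_curveHull (h : SchanuelOn curveHull) : ProductSchanuel ∧ RelTowerSchanuel :=
  structural_iff_schanuelOn_curveHull.2 h

/-- **THE HULLS COINCIDE** under `TowerSchanuel`: `𝒯̂ = 𝓚`. -/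
theorem towerHull_eq_curveHull (hTS : TowerSchanuel) : towerHull hTS = curveHull := by
  refine le_antisymm ?_ (curveHull_le_towerHull hTS)
  intro x hx
  obtain ⟨N, b, hb, hbtow, hxb⟩ := hx
  have hbK : ∀ i, b i ∈ curveHull :=
    tower_mem_of_isCurveClosed curveHull isCurveClosed_curveHull (schanuelOn_curveHull_of_towerSchanuel hTS) N b hb hbtow
  exact (Submodule.span_le.2 (Set.range_subset_iff.2 hbK)) hxb

/-- As sets, the tower hull equals the curve hull (under tower Schanuel). -/
theorem towerHullSet_eq_curveHull (hTS : TowerSchanuel) : towerHullSet = (↑curveHull : Set ℂ) := by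
  rw [← towerHull_eq_curveHull hTS]
  rfl

/-- `𝒯̂ = 𝓚` is the LEAST curve-closed subspace on which Schanuel holds (under `TowerSchanuel`). -/
theorem towerHull_le_of_isCurveClosed (hTS : TowerSchanuel) (K : Submodule ℚ ℂ) (hK : IsCurveClosed K) (hS : SchanuelOn K) :
    towerHull hTS ≤ K := by
  intro x hx
  obtain ⟨N, b, hb, hbtow, hxb⟩ := hx
  exact (Submodule.span_le.2 (Set.range_subset_iff.2 (tower_mem_of_isCurveClosed K hK hS N b hb hbtow))) hxb

/-- For TUPLES (the hypothesis of `BridgeTransverse`, in its inline form): under 1H's structural side,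
«`y` lies in the span of some `ℚ`-free tower tuple» ↔ «every coordinate of `y` lies in `𝓚`». -/
theorem inTowerHull_iff_mem_curveHull (hPS : ProductSchanuel) (hRT : RelTowerSchanuel) {n : ℕ} (y : Fin n → ℂ) :
    (∃ (N : ℕ) (b : Fin N → ℂ), LinearIndependent ℚ b ∧
      (∀ (k : ℕ) (hk : k ≤ N), Algebra.trdeg ℚ ↥(IntermediateField.adjoin ℚ (Set.range (b ∘ Fin.castLE hk) ∪
        Set.range (Complex.exp ∘ (b ∘ Fin.castLE hk)))) ≤ (k : Cardinal)) ∧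
      ∀ j, y j ∈ Submodule.span ℚ (Set.range b)) ↔ ∀ j, y j ∈ curveHull := by
  have hTS := towerSchanuel_of_structural hPS hRT
  constructor
  · rintro ⟨N, b, hb, hbtow, hmem⟩ j
    rw [← towerHull_eq_curveHull hTS]
    exact ⟨N, b, hb, hbtow, hmem j⟩
  · intro h
    exact exists_tower_of_mem_towerHullSet hTS fun j => curveHull_le_towerHull hTS (h j)

/-- **P-BRIDGE⋆-OFF-CURVE**: the text of `RootDecomp1H.BridgeTransverse` (stmt-Schanuel-30564) with its tower-hull hypothesis
`¬ ∃ N b, …` replaced by «some coordinate of `y` lies outside 1J's curve hull `𝓚`». -/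
def BridgeOffCurve : Prop :=
  ∀ (n c : ℕ), (∀ m < n, Literature.NumberTheory.Transcendental.SchanuelRank m) → ∀ y : Fin n → ℂ, (((∃ g : Fin n → MvPolynomial (Fin n ⊕ Fin n) ℚ, (∀ i, max (g i).totalDegree ((g i).support.sup fun m => max ((g i).coeff m).num.natAbs ((g i).coeff m).den) ≤ c) ∧ (∀ i, MvPolynomial.aeval (Sum.elim y (Complex.exp ∘ y)) (g i) = 0) ∧ (Matrix.of fun i j => MvPolynomial.aeval (Sum.elim y (Complex.exp ∘ y)) (Literature.NumberTheory.Transcendental.Khovanskii.ePD j (g i))).det ≠ 0) ∧ ‖y‖ ≤ ((4 ^ c : ℕ) : ℝ)) ∧ ∀ c' < c, ¬ (∃ y' : Fin n → ℂ, Submodule.span ℚ (Set.range y) = Submodule.span ℚ (Set.range y') ∧ (∃ g' : Fin n → MvPolynomial (Fin n ⊕ Fin n) ℚ, (∀ i, max (g' i).totalDegree ((g' i).support.sup fun m => max ((g' i).coeff m).num.natAbs ((g' i).coeff m).den) ≤ c') ∧ (∀ i, MvPolynomial.aeval (Sum.elim y' (Complex.exp ∘ y')) (g' i) = 0) ∧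 (Matrix.of fun i j => MvPolynomial.aeval (Sum.elim y' (Complex.exp ∘ y')) (Literature.NumberTheory.Transcendental.Khovanskii.ePD j (g' i))).det ≠ 0) ∧ ‖y'‖ ≤ ((4 ^ c' : ℕ) : ℝ))) → (∀ j, (starRingEnd ℂ) (y j) ∈ Submodule.span ℚ (Set.range y)) → (LinearIndependent ℚ y ∧ Algebra.trdeg ℚ ↥(IntermediateField.adjoin ℚ (Set.range y ∪ Set.range (Complex.exp ∘ y))) < (n : Cardinal)) → (¬ ∀ j, y j ∈ curveHull) → (∃ P : Fin (n + 1) → MvPolynomial (Fin n ⊕ Fin n) ℤ, (∀ i, max (P i).totalDegree ((P i).support.sup fun m => ((P i).coeff m).natAbs) ≤ c + 3) ∧ (∀ i, MvPolynomial.aeval (Sum.elim y (Complex.exp ∘ y)) (P i) = 0) ∧ LinearIndependent ℂ (fun i => fun s : Fin n ⊕ Fin n => MvPolynomial.aeval (Sum.elim y (Complex.exp ∘ y)) (MvPolynomial.pderiv s (P i))))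

/-- **ONE RESIDUAL DOMAIN**: under 1H's structural side its declared residual `BridgeTransverse` IS the gap principle off 1J's
curve hull — the complement on which 1J's residual `SchanuelOverCurveClosedFields = G₂ ∧ K₃` lives. -/
theorem bridgeTransverse_iff_bridgeOffCurve (hPS : ProductSchanuel) (hRT : RelTowerSchanuel) :
    BridgeTransverse ↔ BridgeOffCurve :=
  ⟨fun h n c hlow y hopt hcs hce hnK => h n c hlow y hopt hcs hce fun hh =>
      hnK ((inTowerHull_iff_mem_curveHull hPS hRT y).1 hh),
    fun h n c hlow y hopt hcs hce hnh => h n c hlow y hopt hcs hce fun hK =>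
      hnh ((inTowerHull_iff_mem_curveHull hPS hRT y).2 hK)⟩

/-- `Schanuel` is Schanuel on the top subspace. -/
theorem schanuel_iff_schanuelOn_top : _root_.Schanuel ↔ SchanuelOn ⊤ :=
  ⟨fun h n x _ hx => h n x hx, fun h n x hx => h n x (fun _ => Submodule.mem_top) hx⟩

/-- **INTERCHANGEABILITY, 1H ⟹ 1J**: 1H's TWO structural items replace 1J's SIX in 1J's assembly —
`1H.ProductSchanuel → 1H.RelTowerSchanuel → 1J.SchanuelOverCurveClosedFields → Schanuel` (engine: `RootDecomp1DFlagSplit.schanuelOn_of_relOn`). -/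
theorem schanuel_of_structural_of_curveClosedFields (hPS : ProductSchanuel) (hRT : RelTowerSchanuel)
    (hK2 : SchanuelOverCurveClosedFields) : _root_.Schanuel :=
  schanuel_iff_schanuelOn_top.2
    (schanuelOn_of_relOn (E := curveHull) (E' := ⊤) (schanuelOn_curveHull_of_structural hPS hRT)
      fun k m y z hy _ hz => hK2 k m y z hy hz)

/-- … and with 1J's round-6 split of `K₂` (G₂ = stmt-Schanuel-30522, K₃ = 30523; glue 30524 landed as
`RootDecomp1JPairSplit.schanuelOverCurveClosedFieldsGlue_holds`). -/
theorem schanuel_of_structural_of_pairSplit (hPS : ProductSchanuel) (hRT : RelTowerSchanuel)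
    (hG2 : PairBlocksOverCurveClosedFields) (hK3 : SchanuelOverPairClosedFields) : _root_.Schanuel :=
  schanuel_of_structural_of_curveClosedFields hPS hRT (schanuelOverCurveClosedFieldsGlue_holds hG2 hK3)

/-- Exactness: every statement here is implied by `Schanuel`. -/
theorem towerSchanuel_of_schanuel (h : _root_.Schanuel) : TowerSchanuel := fun N b _ hb => h N b hb

/-- Schanuel gives Schanuel on the curve hull (restriction). -/
theorem schanuelOn_curveHull_of_schanuel (h : _root_.Schanuel) : SchanuelOn curveHull := fun n x _ hx => h n x hx

end Summit.Schanuel.Schanuel.Theorems.RootDecomp1HCurveHull
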